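import Summits.ResolutionOfSingularities.ResolutionOfSingularities.Theorems.MarkedTransferCampaignW46ThreadChain
import HarnessLib

/-!
# [OURS · L1 W4.6 rung (i-b)] Loose thread chains: the local algebra of a chain of infinitely near singular points of
# `(J, b)` on a surface when CURVES OF THE SINGULAR LOCUS MAY ALSO BE BLOWN UP — the structure, the loose transform law,
# the curve/point cases
# (cell res-hironaka, LADDER-RESOLUTION rung L, D-0089; campaign s46, prover res-L1-s46-pv-1; host route MarkedTransfer,
# `--supports stmt-ResolutionOfSingularities-16155`)

HONEST FRAMING. Nothing here is a statement of H. Hironaka's manuscript (2017-03-23, [Hironaka2017]) and nothing here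
asserts that any statement of it holds. This is PURE COMMUTATIVE ALGEBRA inside a field `F`, over the tree's theory of
quadratic transforms (`Resolution/QuadraticTransforms*.lean`) and the thread chains of rung (i-a)
(`MarkedTransferCampaignW46ThreadChain.lean`, p503244; theorem `CampaignW46.not_isThreadChain`, p511241). AI review is
weaker than expert review. No `sorry`; axioms standard.

## Why (rung (i-b): «procrastination is the only obstruction on surfaces»)

Rung (i-a) concerns permissible sequences on surfaces whose singular loci stay FINITE: every step blows up an isolated
singular point, and along a thread of infinitely near singular points the stalk ideals obey the transform law of Def. 2.1,
`J_{k+1} = x_k^{-b} · J_k R_{k+1}` — a THREAD CHAIN. When the singular locus `Sing(J_k, b)` is allowed to contain curves, a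
permissible sequence may also blow up a regular curve `C ⊆ Sing` through the thread point: on a surface this does not change
the local ring (the blow-up of a Cartier divisor is an isomorphism) but divides the stalk ideal by the `b`-th power of a
local equation of `C`. If the POINT blow-ups of the sequence never centre at a point lying on a curve of the singular locus
(no «procrastination»), then at every point blow-up of the thread the stalk ideal is of isolated type (`J_k ⊄ (π^b)` for every
prime `π`), and between two point blow-ups of the thread the only curve of the singular locus through the thread point is the
last exceptional curve (any other would contract to a curve of `Sing` through the previous thread point). What is left in the
function field is therefore a chain of quadratic transforms with the LOOSE transform law
`x_k^{m_k} · J_{k+1} = J_k R_{k+1}`, `m_k ≥ b` ARBITRARY (`m_k = b + b·c_k`, `c_k` = the number of times the exceptional curve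
of step `k` was blown up before the next point blow-up of the thread). This file sets up these LOOSE THREAD CHAINS; the
companions prove that none exists (`CampaignW46.not_isLooseThreadChain`), generalising the thread-chain theorem (`m_k = b`).

## Contents (this file)

* `IsLooseThreadChain b m R J` — the structure: as `IsThreadChain` but with the loose law in PRODUCT form
  `(x^{m k}) · J (k+1) = J k · R (k+1)` for every generator `x` of `𝔪_k R (k+1)`, exponents `b ≤ m k`.
* bookkeeping (`le_succ`, `mono`, `dominates`, `isLocalRingOf'`, `exists_generator`, `extIdeal_le_span_pow`).
* `IsThreadChain.isLooseThreadChain` — every thread chain is a loose thread chain with `m ≡ b`.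
* **The curve and point cases** (`false_of_ringKrullDim_le_one`): no member of a loose thread chain has dimension `≤ 1`.

## References

* O. Zariski, P. Samuel, *Commutative Algebra* II (1960), Appendix 5. [ZariskiSamuel1960]
* S. S. Abhyankar, Amer. J. Math. 78 (1956), Lemma 12, Thm. 3. [Abhyankar1956Valuations]
* companion modules of this campaign: `MarkedTransferCampaignW46ThreadChain*.lean` (p503244 … p511241).
-/

noncomputable section

set_option linter.dupNamespace false -- mandated namespace of this single-conjunct summit

open IsLocalRing

namespace Summit.ResolutionOfSingularities.ResolutionOfSingularities.Theorems

namespace CampaignW46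

open Literature.AlgebraicGeometry.Resolution

universe u

variable {F : Type u} [Field F]

/-! ## Loose thread chains -/

/-- [OURS · L1 W4.6 rung (i-b)] NOT a statement of the manuscript. **A loose thread chain with exponent `b` and division
exponents `m k ≥ b`** in the field `F`: local rings `R k ⊆ F`, regular of dimension `≤ 2`, `R 0` with fraction field `F`,
`R (k+1)` a quadratic transform of `R k`; non-zero ideals `J k ⊆ 𝔪_k^b` of `R k` obeying the LOOSE transform law in product
form `(x^{m k}) · J (k+1) = J k · R (k+1)` for every generator `x` of `𝔪_k R (k+1)` (Def. 2.1 read in the stalks along a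
chain of infinitely near points, each blown up, followed by `(m k - b)/b` blow-ups of the new exceptional curve); isolated
type at every stage: `J k ⊄ (π^b)` for every prime element `π` of `R k` with `(π) ≠ 𝔪_k`; and module-finite normalizations
of the quotient domains of the `R k` (excellence of the stalks). [folklore] -/
structure IsLooseThreadChain (b : ℕ) (m : ℕ → ℕ) (R : ℕ → Subring F) (J : ∀ k, Ideal (R k)) : Prop where
  /-- `b > 0` -/
  b_pos : 0 < b
  /-- the division exponents are at least `b` -/
  le_exponent : ∀ k, b ≤ m k
  /-- `Frac (R 0) = F` -/
  isLocalRingOf : IsLocalRingOf (R 0)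
  /-- every `R k` is a regular local ring -/
  isRegularLocalRing : ∀ k, IsRegularLocalRing (R k)
  /-- of Krull dimension at most two -/
  ringKrullDim_le : ∀ k, ringKrullDim (R k) ≤ 2
  /-- `R (k+1)` is a quadratic transform of `R k` -/
  isQuadraticTransform : ∀ k, IsQuadraticTransform (R k) (R (k + 1))
  /-- the loose transform law `(x^{m k}) · J (k+1) = J k · R (k+1)` for every generator `x` of `𝔪_k R (k+1)` -/
  transform : ∀ k (x : F) (hx1 : x ∈ R (k + 1)),
    extIdeal (@maximalIdeal (R k) _ (isRegularLocalRing k).toIsLocalRing) (R (k + 1)) =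
      Ideal.span {(⟨x, hx1⟩ : R (k + 1))} →
    Ideal.span {(⟨x, hx1⟩ : R (k + 1)) ^ m k} * J (k + 1) = extIdeal (J k) (R (k + 1))
  /-- `J k ≠ 0` -/
  ne_bot : ∀ k, J k ≠ ⊥
  /-- the thread is singular: `J k ⊆ 𝔪_k^b` -/
  le_pow : ∀ k, J k ≤ (@maximalIdeal (R k) _ (isRegularLocalRing k).toIsLocalRing) ^ b
  /-- isolated type: no height-one prime `(π) ≠ 𝔪_k` has `J k ⊆ (π^b)` -/
  not_le_span_pow : ∀ k (π : R k), Prime π →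
    Ideal.span {π} ≠ @maximalIdeal (R k) _ (isRegularLocalRing k).toIsLocalRing → ¬ J k ≤ Ideal.span {π ^ b}
  /-- module-finite normalization of the quotient domains -/
  finite_integralClosure : ∀ k (P : Ideal (R k)), P.IsPrime →
    Module.Finite (R k ⧸ P) (integralClosure (R k ⧸ P) (FractionRing (R k ⧸ P)))

namespace IsLooseThreadChain

variable {b : ℕ} {m : ℕ → ℕ} {R : ℕ → Subring F} {J : ∀ k, Ideal (R k)}

/-- `R k ≤ R (k+1)` in a loose thread chain. [folklore] -/
theorem le_succ (h : IsLooseThreadChain b m R J) (k : ℕ) : R k ≤ R (k + 1) :=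
  (h.isQuadraticTransform k).dominates.1

/-- The loose chain is monotone. [folklore] -/
theorem mono (h : IsLooseThreadChain b m R J) : Monotone R := monotone_nat_of_le_succ h.le_succ

/-- `R j` dominates `R i` for `i ≤ j` in a loose thread chain. [folklore] -/
theorem dominates (h : IsLooseThreadChain b m R J) {i j : ℕ} (hij : i ≤ j) : SubringDominates (R i) (R j) := by
  induction hij with
  | refl => exact SubringDominates.refl _
  | step _ ih => exact ih.trans (h.isQuadraticTransform _).dominates

/-- Every member of a loose thread chain has fraction field `F`. [folklore] -/
theorem isLocalRingOf' (h : IsLooseThreadChain b m R J) (k : ℕ) : IsLocalRingOf (R k) := by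
  haveI := (h.isRegularLocalRing k).toIsLocalRing
  exact isLocalRingOf_of_le h.isLocalRingOf (h.mono (Nat.zero_le k))

/-- The division exponents of a loose thread chain are positive. [folklore] -/
theorem exponent_pos (h : IsLooseThreadChain b m R J) (k : ℕ) : 0 < m k :=
  h.b_pos.trans_le (h.le_exponent k)

/-! ## A generator of `𝔪_k R (k+1)` and the loose transform law -/

/-- **The chart element** of a step of a loose thread chain: some non-zero `x ∈ 𝔪_k` with `R k[𝔪_k/x] ⊆ R (k+1)`; then
`𝔪_k R (k+1) = x R (k+1)`. [cite: Cutkosky2014, §2.1] -/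
theorem exists_generator (h : IsLooseThreadChain b m R J) (k : ℕ) : ∃ (x : F) (hx : x ∈ R k), x ≠ 0 ∧
    (haveI := (h.isRegularLocalRing k).toIsLocalRing; (⟨x, hx⟩ : R k) ∈ maximalIdeal (R k)) ∧
    (haveI := (h.isRegularLocalRing k).toIsLocalRing; blowupRing (R k) x ≤ R (k + 1)) ∧
    ∃ hx1 : x ∈ R (k + 1), (haveI := (h.isRegularLocalRing k).toIsLocalRing;
      extIdeal (maximalIdeal (R k)) (R (k + 1))) = Ideal.span {(⟨x, hx1⟩ : R (k + 1))} := by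
  haveI := (h.isRegularLocalRing k).toIsLocalRing
  obtain ⟨_, x, hxm, hx0, -, hT, -, -⟩ := h.isQuadraticTransform k
  have hx0' : (x : F) ≠ 0 := fun e => hx0 (Subtype.ext e)
  have hx1 : (x : F) ∈ R (k + 1) := h.le_succ k x.2
  refine ⟨x, x.2, hx0', hxm, hT, hx1, ?_⟩
  rw [extIdeal_eq_map _ (h.le_succ k)]
  apply le_antisymm
  · rw [Ideal.map_le_iff_le_comap]
    intro y hy
    rw [Ideal.mem_comap, Ideal.mem_span_singleton']
    refine ⟨⟨(y : F) / x, hT (div_mem_blowupRing _ hy)⟩, Subtype.ext ?_⟩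
    change (y : F) / x * x = y
    rw [div_mul_cancel₀ _ hx0']
  · rw [Ideal.span_singleton_le_iff_mem]
    exact Ideal.mem_map_of_mem (Subring.inclusion (h.le_succ k)) hxm

/-- **The loose transform law** of a loose thread chain: `x^{m k} · J (k+1) = J k · R (k+1)` for a generator `x` of
`𝔪_k R (k+1)` (the structure field, dot-notation form). [folklore] -/
theorem span_pow_mul_eq (h : IsLooseThreadChain b m R J) (k : ℕ) {x : F} (hx1 : x ∈ R (k + 1))
    (hmx : (haveI := (h.isRegularLocalRing k).toIsLocalRing;
      extIdeal (maximalIdeal (R k)) (R (k + 1))) = Ideal.span {(⟨x, hx1⟩ : R (k + 1))}) :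
    Ideal.span {(⟨x, hx1⟩ : R (k + 1)) ^ m k} * J (k + 1) = extIdeal (J k) (R (k + 1)) :=
  h.transform k x hx1 hmx

/-- In a loose thread chain `J k · R (k+1) ⊆ (x^{m k})` for a generator `x` of `𝔪_k R (k+1)`: the division exponent never
exceeds the `x`-adic order of the extended ideal. [folklore] -/
theorem extIdeal_le_span_pow (h : IsLooseThreadChain b m R J) (k : ℕ) {x : F} (hx1 : x ∈ R (k + 1))
    (hmx : (haveI := (h.isRegularLocalRing k).toIsLocalRing;
      extIdeal (maximalIdeal (R k)) (R (k + 1))) = Ideal.span {(⟨x, hx1⟩ : R (k + 1))}) :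
    extIdeal (J k) (R (k + 1)) ≤ Ideal.span {(⟨x, hx1⟩ : R (k + 1)) ^ m k} := by
  rw [← h.span_pow_mul_eq k hx1 hmx]
  exact Ideal.mul_le_right

/-- Membership form of the loose transform law: for `y ∈ J k` there is `z ∈ J (k+1)` with `y = x^{m k} z` in `R (k+1)`.
[folklore] -/
theorem exists_eq_pow_mul (h : IsLooseThreadChain b m R J) (k : ℕ) {x : F} (hx1 : x ∈ R (k + 1))
    (hmx : (haveI := (h.isRegularLocalRing k).toIsLocalRing;
      extIdeal (maximalIdeal (R k)) (R (k + 1))) = Ideal.span {(⟨x, hx1⟩ : R (k + 1))})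
    {y : R k} (hy : y ∈ J k) :
    ∃ z ∈ J (k + 1), Subring.inclusion (h.le_succ k) y = (⟨x, hx1⟩ : R (k + 1)) ^ m k * z := by
  have hyext : Subring.inclusion (h.le_succ k) y ∈ extIdeal (J k) (R (k + 1)) := by
    rw [extIdeal_eq_map _ (h.le_succ k)]; exact Ideal.mem_map_of_mem _ hy
  rw [← h.span_pow_mul_eq k hx1 hmx, Ideal.mem_span_singleton_mul] at hyext
  obtain ⟨z, hz, hzy⟩ := hyext
  exact ⟨z, hz, hzy.symm⟩

end IsLooseThreadChain

/-- **Every thread chain is a loose thread chain** with constant division exponents `m ≡ b` (the product form of the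
transform law of Def. 2.1, `IsThreadChain.span_pow_mul_eq`). So `not_isLooseThreadChain` (companion file
`MarkedTransferCampaignW46LooseThreadFollowed.lean`) generalises the thread-chain theorem `not_isThreadChain`. [folklore] -/
theorem IsThreadChain.isLooseThreadChain {b : ℕ} {R : ℕ → Subring F} {J : ∀ k, Ideal (R k)}
    (h : IsThreadChain b R J) : IsLooseThreadChain b (fun _ => b) R J where
  b_pos := h.b_pos
  le_exponent _ := le_rfl
  isLocalRingOf := h.isLocalRingOf
  isRegularLocalRing := h.isRegularLocalRing
  ringKrullDim_le := h.ringKrullDim_le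
  isQuadraticTransform := h.isQuadraticTransform
  transform k _ hx1 hmx := h.span_pow_mul_eq k hx1 hmx
  ne_bot := h.ne_bot
  le_pow := h.le_pow
  not_le_span_pow := h.not_le_span_pow
  finite_integralClosure := h.finite_integralClosure

namespace IsLooseThreadChain

variable {b : ℕ} {m : ℕ → ℕ} {R : ℕ → Subring F} {J : ∀ k, Ideal (R k)}

/-! ## The curve and point cases -/

/-- **No loose thread chain has a member of dimension `≤ 1`.** A regular local ring of dimension `≤ 1` is a field or a
discrete valuation ring: a field has `J k ⊆ 𝔪^b = 0`; a discrete valuation ring `V` of `F` is dominated by, hence equal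
to, all later members, and there the loose law reads `x^{m k} · J (k+1) = J k · V` with `x ∈ 𝔪_V`, `m k ≥ b ≥ 1`, so the
exponents `n_k` (`J k = 𝔪^{n_k}`) would satisfy `n_{k+1} < n_k` forever. [folklore] -/
theorem false_of_ringKrullDim_le_one (h : IsLooseThreadChain b m R J) {k₀ : ℕ} (hk₀ : ringKrullDim (R k₀) ≤ 1) :
    False := by
  classical
  haveI hreg := h.isRegularLocalRing k₀
  haveI : IsPrincipalIdealRing (R k₀) := isPrincipalIdealRing_of_ringKrullDim_le_one hk₀
  have hb : 0 < b := h.b_pos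
  -- not a field: else `J k₀ ⊆ 𝔪^b = ⊥`
  have hmne : maximalIdeal (R k₀) ≠ ⊥ := by
    intro hm
    apply h.ne_bot k₀
    have h1 := h.le_pow k₀
    rw [hm, ← Ideal.zero_eq_bot, zero_pow hb.ne', Ideal.zero_eq_bot] at h1
    exact le_bot_iff.mp h1
  haveI hdvr : IsDiscreteValuationRing (R k₀) :=
    { not_a_field' := hmne }
  -- `R k₀` is a valuation ring of `F`
  haveI : ValuationRing (R k₀) := inferInstance
  have hval : ∀ z : F, z ∈ R k₀ ∨ z⁻¹ ∈ R k₀ := by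
    intro z
    obtain ⟨a, ha, c, hc, hc0, rfl⟩ := (h.isLocalRingOf' k₀).2 z
    obtain ⟨e, he⟩ := ValuationRing.cond (⟨a, ha⟩ : R k₀) ⟨c, hc⟩
    rcases he with he | he
    · -- `a e = c`: `z = a / (a e)`
      have he' : a * (e : F) = c := by have := congrArg Subtype.val he; simpa using this
      by_cases ha0 : a = 0
      · left; rw [ha0, zero_div]; exact (R k₀).zero_mem
      · right
        rw [inv_div, ← he', mul_div_cancel_left₀ _ ha0]
        exact e.2
    · -- `c e = a`: `z = e`
      have he' : c * (e : F) = a := by have := congrArg Subtype.val he; simpa using this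
      left
      rw [← he', mul_comm, mul_div_assoc, div_self hc0, mul_one]
      exact e.2
  -- all later members equal `R k₀`
  have heq : ∀ j, R (k₀ + j) = R k₀ := by
    intro j
    induction j with
    | zero => rfl
    | succ j ih =>
      have hdom : SubringDominates (R (k₀ + j)) (R (k₀ + j + 1)) := (h.isQuadraticTransform _).dominates
      rw [ih] at hdom
      exact eq_of_subringDominates_of_forall_mem_or_inv_mem hval hdom
  -- transport the ideals to `V = R k₀`
  let ι : ∀ j, R (k₀ + j) →+* R k₀ := fun j => Subring.inclusion (heq j).le
  have hιinj : ∀ j, Function.Injective (ι j) := fun j => Subring.inclusion_injective _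
  let I : ℕ → Ideal (R k₀) := fun j => (J (k₀ + j)).map (ι j)
  have hI0 : ∀ j, I j ≠ ⊥ := fun j hj =>
    h.ne_bot (k₀ + j) ((Ideal.map_eq_bot_iff_of_injective (hιinj j)).mp hj)
  obtain ⟨ϖ, hϖ⟩ := IsDiscreteValuationRing.exists_irreducible (R k₀)
  have hmax : maximalIdeal (R k₀) = Ideal.span {ϖ} :=
    (IsDiscreteValuationRing.irreducible_iff_uniformizer ϖ).mp hϖ
  have hex : ∀ j, ∃ n : ℕ, I j = Ideal.span {ϖ ^ n} := fun j =>
    IsDiscreteValuationRing.ideal_eq_span_pow_irreducible (hI0 j) hϖ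
  choose n hn using hex
  -- the loose law gives `I j ⊆ 𝔪^(m + n (j+1))`
  have hstep : ∀ j, n (j + 1) + m (k₀ + j) ≤ n j := by
    intro j
    obtain ⟨x, hxR, hx0, hxm, -, hx1, hmx⟩ := h.exists_generator (k₀ + j)
    -- `x` is a non-unit of `V`
    haveI : IsLocalRing (R (k₀ + j)) := (h.isRegularLocalRing _).toIsLocalRing
    have hxV : (ι (j + 1) ⟨x, hx1⟩) ∈ maximalIdeal (R k₀) := by
      rw [mem_maximalIdeal_iff_inv_not_mem] at hxm ⊢
      rcases hxm with hxm | hxm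
      · exact absurd hxm hx0
      · right
        change x⁻¹ ∉ R k₀
        rwa [← heq j]
    have hle : I j ≤ maximalIdeal (R k₀) ^ (m (k₀ + j) + n (j + 1)) := by
      change (J (k₀ + j)).map (ι j) ≤ _
      rw [Ideal.map_le_iff_le_comap]
      intro y hy
      rw [Ideal.mem_comap]
      obtain ⟨z, hz, hzy⟩ := h.exists_eq_pow_mul (k₀ + j) hx1 hmx hy
      have e1 : ι j y = (ι (j + 1) ⟨x, hx1⟩) ^ m (k₀ + j) * ι (j + 1) z := by
        apply Subtype.ext
        change (y : F) = x ^ m (k₀ + j) * (z : F)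
        have := congrArg Subtype.val hzy
        simp only [Subring.coe_mul, SubmonoidClass.coe_pow] at this
        exact this
      rw [e1, pow_add]
      refine Ideal.mul_mem_mul (Ideal.pow_mem_pow hxV _) ?_
      have hz' : ι (j + 1) z ∈ I (j + 1) := Ideal.mem_map_of_mem _ hz
      rw [hn (j + 1), ← Ideal.span_singleton_pow, ← hmax] at hz'
      exact hz'
    rw [hn j, hmax, Ideal.span_singleton_pow, Ideal.span_singleton_le_span_singleton] at hle
    have := (pow_dvd_pow_iff hϖ.ne_zero hϖ.not_isUnit).mp hle
    omega
  -- descent: `n (j+1) < n j`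
  have hdec : ∀ j, n j + j ≤ n 0 := by
    intro j
    induction j with
    | zero => simp
    | succ j ih =>
      have h1 := hstep j
      have h2 : 1 ≤ m (k₀ + j) := h.exponent_pos (k₀ + j)
      omega
  have hfin := hdec (n 0 + 1)
  omega

end IsLooseThreadChain

end CampaignW46

end Summit.ResolutionOfSingularities.ResolutionOfSingularities.Theorems

end
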